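import Mathlib
import Summits.QuantumFields.YangMills.Theorems.IsotropyFromPowerCountingCurvatureSandwichBoundChainEngine
import Summits.QuantumFields.YangMills.Theorems.MirrorModularBoostsPlanarSpectralConeDensityHelpers
import HarnessLib

/-!
# Stub `stub_descent` for the crux `CurvatureSandwichBound` (line `Sketch`): descent from a dense class

Support file for crux stmt-QuantumFields-18372 (`IsotropyFromPowerCounting.CurvatureSandwichBound`),
registered skeleton `Cruxes/CurvatureSandwichBound/Lines/Sketch.lean` (v4), stub (DE).

Fix a one-species family `T` on `ℝ⁴` with an `e₀`-reconstruction `h : OSReconstructionNoE1 T.toLabelled`,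
a windowed insertion `f₁` (`tsupport f₁ ⊆ {u ≤ x⁰ ≤ 2u}`), `s = 2u + v`, the sandwich `X W := f₁ ⊗ T_s W`
and its formal adjoint `X♯ E := T_s (f₁† ⊗ E)` (`f₁† = osAdjoint f₁`).

* `isTimeOrdered_sandwich`, `isTimeOrdered_sharp`: `X W` and `X♯ E` are time-ordered whenever `W`, `E`
  are (support bookkeeping as in `stub_chainOrdered`).
* `descent_pointwise`, `inner_fieldVec_sandwich`: **the descent identity**
  `⟪Ψ_E, Ψ_{XW}⟫ = ⟪Ψ_{X♯E}, Ψ_W⟫` (Osterwalder–Schrader 1973, (4.7): `𝔖(ΘE* ⊗ f₁ ⊗ T_sW)` and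
  `𝔖(Θ(T_s(f₁† ⊗ E))* ⊗ W)` are the same distribution on configurations differing by the diagonal
  translation `s e₀`, read through the arity cast `m + (1 + n) = (1 + m) + n`; translation invariance on
  `⁰𝒮` removes the shift).
* `exists_sharp`: the identity extends sesquilinearly to every finite combination `Φ = v(w)` of
  generators: there is `Φ♯` with `⟪Φ, Ψ_{XW}⟫ = ⟪Φ♯, Ψ_W⟫` for all time-ordered `W`.
* `stub_descent` (**the stub**): if `X` is bounded by `Λ` on finite combinations of the field vectors of
  a class `𝒯` spanning a dense subspace, then `‖Ψ_{XW}‖ ≤ Λ ‖Ψ_W‖` for every time-ordered `W` —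
  `|⟪Φ, Ψ_{XW}⟫| = |⟪Φ♯, Ψ_W⟫| ≤ ‖Φ‖ Λ ‖Ψ_W‖` by approximating `Ψ_W` from the span and reading the
  identity backwards, then density of the `Φ`'s (`denseRange_vec`).

References: K. Osterwalder, R. Schrader, Comm. Math. Phys. 31 (1973) §4.1 (4.7); J. Glimm, A. Jaffe,
*Quantum Physics* (2nd ed. 1987), §6.1, §10.5.
-/

noncomputable section

namespace Summit.QuantumFields.YangMills.Theorems.CurvatureSandwichBound.Sketch

open scoped BigOperators SchwartzMap InnerProductSpace
open MeasureTheory Filter Topology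
open Literature.MathematicalPhysics.QuantumLattice Literature.MathematicalPhysics.AQFT
  Literature.MathematicalPhysics.QuantumFieldTheory Literature.Probability.LatticeModels
open Summit.QuantumFields.YangMills.Theorems.NPointIsotropy.Negative (E4)

/-! ### Time-ordering of the sandwich and of its formal adjoint -/

/-- **`X W = f₁ ⊗ T_s W` is time-ordered** for every time-ordered `W` (`s = 2u + v`, `f₁` windowed in
`[u, 2u]`): the head point has time in `[u, 2u]`, the tail points have strictly increasing times `> s > 2u`. -/
theorem isTimeOrdered_sandwich (u v : ℝ) (hu : 0 < u) (hv : 0 < v) (f₁ : 𝓢((Fin 1 → E4), ℂ))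
    (hf₁ : tsupport (f₁ : (Fin 1 → E4) → ℂ) ⊆ {x | u ≤ x 0 0 ∧ x 0 0 ≤ 2 * u})
    {n : ℕ} {W : 𝓢((Fin n → E4), ℂ)} (hW : IsTimeOrdered W) :
    IsTimeOrdered (f₁.appendTensor (translateMulti ((2 * u + v) • EuclideanSpace.single 0 1) W)) := by
  -- adapted from `stub_chainOrdered` (…CurvatureSandwichBoundChainOrdered.lean), part (2)
  have ha0 : ((2 * u + v) • EuclideanSpace.single 0 1 : E4) 0 = 2 * u + v :=
    smul_single_apply_zero _
  intro x hx
  obtain ⟨hxA, hxB⟩ := OSReconstructionNoE1.tsupport_appendTensor_subset _ _ hx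
  have hf : u ≤ x (Fin.castAdd n 0) 0 ∧ x (Fin.castAdd n 0) 0 ≤ 2 * u := hf₁ hxA
  have hT : (∀ j, 0 < (x (Fin.natAdd 1 j) - (2 * u + v) • EuclideanSpace.single 0 1 : E4) 0) ∧
      StrictMono fun j => (x (Fin.natAdd 1 j) - (2 * u + v) • EuclideanSpace.single 0 1 : E4) 0 :=
    hW (OSReconstructionNoE1.tsupport_translateMulti_subset _ _ hxB)
  simp only [PiLp.sub_apply, ha0] at hT
  refine timeOrdered_of_head_tail x (by linarith [hf.1]) (fun j => ?_) (fun i j hij => ?_)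
  · have := hT.1 j
    linarith [hf.2]
  · have := hT.2 hij
    simp only at this
    linarith

/-- **`X♯ E = T_s (f₁† ⊗ E)` is time-ordered** for every time-ordered `E`: the head point (`f₁†` lives at
times `[-2u, -u]`, shifted by `s = 2u + v`) has time in `[v, u + v]`, the tail points have strictly
increasing times `> s > u + v`. -/
theorem isTimeOrdered_sharp (u v : ℝ) (hu : 0 < u) (hv : 0 < v) (f₁ : 𝓢((Fin 1 → E4), ℂ))
    (hf₁ : tsupport (f₁ : (Fin 1 → E4) → ℂ) ⊆ {x | u ≤ x 0 0 ∧ x 0 0 ≤ 2 * u})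
    {m : ℕ} {E : 𝓢((Fin m → E4), ℂ)} (hE : IsTimeOrdered E) :
    IsTimeOrdered (translateMulti ((2 * u + v) • EuclideanSpace.single 0 1)
      ((osAdjoint f₁).appendTensor E)) := by
  -- adapted from `stub_chainOrdered` (…CurvatureSandwichBoundChainOrdered.lean), part (1)
  have ha0 : ((2 * u + v) • EuclideanSpace.single 0 1 : E4) 0 = 2 * u + v :=
    smul_single_apply_zero _
  have hrev : Fin.rev (0 : Fin 1) = 0 := Subsingleton.elim _ _
  intro x hx
  obtain ⟨hyA, hyB⟩ := OSReconstructionNoE1.tsupport_appendTensor_subset _ _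
    (OSReconstructionNoE1.tsupport_translateMulti_subset _ _ hx)
  have hf : u ≤ timeReflection 4 (x (Fin.castAdd m (Fin.rev 0)) -
        (2 * u + v) • EuclideanSpace.single 0 1) 0 ∧
      timeReflection 4 (x (Fin.castAdd m (Fin.rev 0)) -
        (2 * u + v) • EuclideanSpace.single 0 1) 0 ≤ 2 * u :=
    hf₁ (OSReconstructionNoE1.tsupport_osAdjoint_subset f₁ hyA)
  rw [hrev, OSReconstructionNoE1.timeReflection_apply_zero, PiLp.sub_apply, ha0] at hf
  have hX : (∀ j, 0 < (x (Fin.natAdd 1 j) - (2 * u + v) • EuclideanSpace.single 0 1 : E4) 0) ∧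
      StrictMono fun j => (x (Fin.natAdd 1 j) - (2 * u + v) • EuclideanSpace.single 0 1 : E4) 0 :=
    hE hyB
  simp only [PiLp.sub_apply, ha0] at hX
  refine timeOrdered_of_head_tail x (by linarith [hf.2]) (fun j => ?_) (fun i j hij => ?_)
  · have := hX.1 j
    linarith [hf.1]
  · have := hX.2 hij
    simp only at this
    linarith

/-! ### The descent identity `⟪Ψ_E, Ψ_{XW}⟫ = ⟪Ψ_{X♯E}, Ψ_W⟫` -/

/-- **Index/blocks bookkeeping for the descent identity.**  For every configuration `z` of
`(1 + m) + n` points, `(Θ(X♯E)* ⊗ W)_{a}(z) = (ΘE* ⊗ X W)(z ∘ Fin.cast)`, `a = s e₀`: the three blocks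
`conj E(θ z_{m-1-j})`, `f₁(z_m)`, `W(z_{m+1+j} - a)` agree (`Θ(F_a)* = (ΘF*)_{-a}`, `θ a = -a`, `ΘΘ = 1`,
and `Θ(f₁† ⊗ E)*` is `ΘE* ⊗ f₁` with the blocks reversed). -/
theorem descent_pointwise (s : ℝ) (f₁ : 𝓢((Fin 1 → E4), ℂ)) {m n : ℕ}
    (E : 𝓢((Fin m → E4), ℂ)) (W : 𝓢((Fin n → E4), ℂ))
    (hN : m + (1 + n) = (1 + m) + n) (z : Fin ((1 + m) + n) → E4) :
    (translateMulti (s • EuclideanSpace.single 0 1)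
        ((osAdjoint (translateMulti (s • EuclideanSpace.single 0 1)
            ((osAdjoint f₁).appendTensor E))).appendTensor W)) z =
      ((osAdjoint E).appendTensor
          (f₁.appendTensor (translateMulti (s • EuclideanSpace.single 0 1) W)))
        (fun i => z (Fin.cast hN i)) := by
  -- adapted from `sandwich_pointwise` (…CurvatureSandwichBoundSandwichAdjoint.lean)
  -- the three index identities (values in `Fin ((1 + m) + n)`)
  have I1 : ∀ j : Fin m, Fin.cast hN (Fin.castAdd (1 + n) (Fin.rev j)) =
      Fin.castAdd n (Fin.rev (Fin.natAdd 1 j)) := fun j => by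
    apply Fin.ext; simp only [Fin.val_cast, Fin.val_castAdd, Fin.val_rev, Fin.val_natAdd]; omega
  have I2 : ∀ l : Fin 1, Fin.cast hN (Fin.natAdd m (Fin.castAdd n l)) =
      Fin.castAdd n (Fin.rev (Fin.castAdd m (Fin.rev l))) := fun l => by
    apply Fin.ext; simp only [Fin.val_cast, Fin.val_castAdd, Fin.val_rev, Fin.val_natAdd]; omega
  have I3 : ∀ j : Fin n, Fin.cast hN (Fin.natAdd m (Fin.natAdd 1 j)) = Fin.natAdd (1 + m) j :=
      fun j => by
    apply Fin.ext; simp only [Fin.val_cast, Fin.val_natAdd]; omega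
  simp only [SchwartzMap.appendTensor_apply, translateMulti_apply, osAdjoint_apply, Function.comp_def,
    map_sub, timeReflection_smul_single, sub_neg_eq_add, add_sub_cancel_right,
    timeReflection_timeReflection, I1, I2, I3, map_mul, Complex.conj_conj]
  ring

/-- **The descent identity** (Osterwalder–Schrader 1973, (4.7), without rotations): with `a = s e₀`,
`X W = f₁ ⊗ T_a W` and `X♯ E = T_a (f₁† ⊗ E)`, `⟪Ψ_E, Ψ_{XW}⟫ = ⟪Ψ_{X♯E}, Ψ_W⟫` whenever the four
field vectors exist.  Both sides are Schwinger function values (`inner_fieldVec_fieldVec`); the right one,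
translated by `a` (translation invariance on `⁰𝒮`, `isOffDiagonal_appendTensor_osAdjoint`), is the left
one read through the arity cast (`descent_pointwise`, `schwinger_congr_cast`). -/
theorem inner_fieldVec_sandwich (T : SchwingerFamily E4) (h : OSReconstructionNoE1 T.toLabelled)
    (s : ℝ) (f₁ : 𝓢((Fin 1 → E4), ℂ)) {m n : ℕ} (k : Fin m → Unit) {E : 𝓢((Fin m → E4), ℂ)}
    {W : 𝓢((Fin n → E4), ℂ)} (hE : IsTimeOrdered E) (hW : IsTimeOrdered W)
    (hXW : IsTimeOrdered (f₁.appendTensor (translateMulti (s • EuclideanSpace.single 0 1) W)))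
    (hXE : IsTimeOrdered (translateMulti (s • EuclideanSpace.single 0 1)
      ((osAdjoint f₁).appendTensor E))) :
    ⟪h.fieldVec m k E hE,
      h.fieldVec (1 + n) (fun _ => ())
        (f₁.appendTensor (translateMulti (s • EuclideanSpace.single 0 1) W)) hXW⟫_ℂ =
    ⟪h.fieldVec (1 + m) (fun _ => ())
        (translateMulti (s • EuclideanSpace.single 0 1) ((osAdjoint f₁).appendTensor E)) hXE,
      h.fieldVec n (fun _ => ()) W hW⟫_ℂ := by
  have hN : m + (1 + n) = (1 + m) + n := by ring
  rw [h.inner_fieldVec_fieldVec _ _ _ _ (isAppendTensorOf_appendTensor _ _),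
    h.inner_fieldVec_fieldVec _ _ _ _ (isAppendTensorOf_appendTensor _ _)]
  simp only [SchwingerFamily.toLabelled_apply]
  have hT := h.translationInvariant ((1 + m) + n) (fun _ => ())
    (s • EuclideanSpace.single 0 1 : E4) _
    (OSReconstructionNoE1.isOffDiagonal_appendTensor_osAdjoint hXE hW)
  simp only [SchwingerFamily.toLabelled_apply] at hT
  rw [← hT]
  exact schwinger_congr_cast T hN _ _ (descent_pointwise s f₁ E W hN)

/-- **Sesquilinear extension of the descent identity to finite combinations of generators**: for every
`w : Gen →₀ ℂ` there is a vector `Φ♯` (namely `Σ_p w_p Ψ_{X♯ F_p}`) with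
`⟪v(w), Ψ_{XW}⟫ = ⟪Φ♯, Ψ_W⟫` for every time-ordered `W` (induction on `w`; `inner_fieldVec_sandwich` on
each generator). -/
theorem exists_sharp (T : SchwingerFamily E4) (h : OSReconstructionNoE1 T.toLabelled) (u v : ℝ)
    (hu : 0 < u) (hv : 0 < v) (f₁ : 𝓢((Fin 1 → E4), ℂ))
    (hf₁ : tsupport (f₁ : (Fin 1 → E4) → ℂ) ⊆ {x | u ≤ x 0 0 ∧ x 0 0 ≤ 2 * u})
    (w : OSReconstructionNoE1.Gen Unit 4 →₀ ℂ) :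
    ∃ Φ' : h.Hilbert, ∀ (n : ℕ) (W : 𝓢((Fin n → E4), ℂ)) (hW : IsTimeOrdered W)
      (hXW : IsTimeOrdered (f₁.appendTensor (translateMulti ((2 * u + v) • EuclideanSpace.single 0 1) W))),
      ⟪h.vec w, h.fieldVec (1 + n) (fun _ => ())
          (f₁.appendTensor (translateMulti ((2 * u + v) • EuclideanSpace.single 0 1) W)) hXW⟫_ℂ =
        ⟪Φ', h.fieldVec n (fun _ => ()) W hW⟫_ℂ := by
  induction w using Finsupp.induction_linear with
  | zero => exact ⟨0, fun n W hW hXW => by simp⟩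
  | add w w' ih ih' =>
    obtain ⟨Φ, hΦ⟩ := ih
    obtain ⟨Φ', hΦ'⟩ := ih'
    exact ⟨Φ + Φ', fun n W hW hXW => by rw [map_add, inner_add_left, inner_add_left, hΦ, hΦ']⟩
  | single p c =>
    obtain ⟨m, k, E, hE⟩ := p
    refine ⟨c • h.fieldVec (1 + m) (fun _ => ())
      (translateMulti ((2 * u + v) • EuclideanSpace.single 0 1) ((osAdjoint f₁).appendTensor E))
      (isTimeOrdered_sharp u v hu hv f₁ hf₁ hE), fun n W hW hXW => ?_⟩
    rw [← Finsupp.smul_single_one, map_smul, inner_smul_left, inner_smul_left,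
      ← inner_fieldVec_sandwich T h (2 * u + v) f₁ k hE hW hXW]
    rfl

/-! ### The stub -/

/-- **Stub (DE) — DESCENT from a dense class of generators to all field vectors (model-blind).**  If the
sandwich `X : Ψ_W ↦ Ψ_{f₁ ⊗ T_s W}` is bounded by `Λ` on all finite combinations of the field vectors of a
class `𝒯` of time-ordered test functions whose field vectors span a dense subspace of `h`, then
`‖Ψ_{f₁ ⊗ T_s W}‖ ≤ Λ ‖Ψ_W‖` for EVERY time-ordered `W`.  Proof: for a finite combination `Φ = v(w)` of
generators, `⟪Φ, Ψ_{XW'}⟫ = ⟪Φ♯, Ψ_{W'}⟫` (`exists_sharp`); on the span of the field vectors of `𝒯`,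
`x = Σ cᵢ Ψ_{Gᵢ}`, reading the identity backwards gives `⟪Φ♯, x⟫ = ⟪Φ, Σ cᵢ Ψ_{XGᵢ}⟫`, so
`|⟪Φ♯, x⟫| ≤ ‖Φ‖ Λ ‖x‖` by the hypothesis; this closed condition passes to the closure of the span, i.e. to
all of `h` (density), in particular to `Ψ_W`: `|⟪Φ, Ψ_{XW}⟫| = |⟪Φ♯, Ψ_W⟫| ≤ ‖Φ‖ Λ ‖Ψ_W‖`; the `Φ` are
dense (`denseRange_vec`), so `Φ → Ψ_{XW}` gives `‖Ψ_{XW}‖² ≤ ‖Ψ_{XW}‖ Λ ‖Ψ_W‖`. -/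
theorem stub_descent :
    ∀ (T : SchwingerFamily E4) (h : OSReconstructionNoE1 T.toLabelled) (u v : ℝ), 0 < u → 0 < v →
    ∀ (f₁ : 𝓢((Fin 1 → E4), ℂ)),
      tsupport (f₁ : (Fin 1 → E4) → ℂ) ⊆ {x | u ≤ x 0 0 ∧ x 0 0 ≤ 2 * u} →
    ∀ (Λ : ℝ), 0 ≤ Λ →
    ∀ (𝒯 : Set (Σ m : ℕ, 𝓢((Fin m → E4), ℂ))) (h𝒯 : ∀ x ∈ 𝒯, IsTimeOrdered x.2),
      Dense ((Submodule.span ℂ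
        {ψ : h.Hilbert | ∃ (x : Σ m : ℕ, 𝓢((Fin m → E4), ℂ)) (hx : x ∈ 𝒯),
          ψ = h.fieldVec x.1 (fun _ => ()) x.2 (h𝒯 x hx)} : Submodule ℂ h.Hilbert) : Set h.Hilbert) →
      (∀ (k : ℕ) (G : Fin k → Σ m : ℕ, 𝓢((Fin m → E4), ℂ)) (hG : ∀ i, G i ∈ 𝒯)
        (hXG : ∀ i, IsTimeOrdered
          (f₁.appendTensor (translateMulti ((2 * u + v) • EuclideanSpace.single 0 1) (G i).2)))
        (c : Fin k → ℂ),
        ‖∑ i, c i • h.fieldVec (1 + (G i).1) (fun _ => ())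
            (f₁.appendTensor (translateMulti ((2 * u + v) • EuclideanSpace.single 0 1) (G i).2)) (hXG i)‖ ≤
          Λ * ‖∑ i, c i • h.fieldVec (G i).1 (fun _ => ()) (G i).2 (h𝒯 _ (hG i))‖) →
    ∀ (n : ℕ) (W : 𝓢((Fin n → E4), ℂ)) (hW : IsTimeOrdered W)
      (hFW : IsTimeOrdered (f₁.appendTensor (translateMulti ((2 * u + v) • EuclideanSpace.single 0 1) W))),
      ‖h.fieldVec (1 + n) (fun _ => ())
          (f₁.appendTensor (translateMulti ((2 * u + v) • EuclideanSpace.single 0 1) W)) hFW‖ ≤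
        Λ * ‖h.fieldVec n (fun _ => ()) W hW‖ := by
  intro T h u v hu hv f₁ hf₁ Λ hΛ 𝒯 h𝒯 hdense hbound n W hW hFW
  -- Step 1: for every finite combination `Φ = v(w)` of generators, `|⟪Φ, Ψ_{XW}⟫| ≤ ‖Φ‖ Λ ‖Ψ_W‖`.
  have hB : ∀ w : OSReconstructionNoE1.Gen Unit 4 →₀ ℂ,
      ‖⟪h.vec w, h.fieldVec (1 + n) (fun _ => ())
          (f₁.appendTensor (translateMulti ((2 * u + v) • EuclideanSpace.single 0 1) W)) hFW⟫_ℂ‖ ≤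
        ‖h.vec w‖ * Λ * ‖h.fieldVec n (fun _ => ()) W hW‖ := by
    intro w
    obtain ⟨Φ', hΦ'⟩ := exists_sharp T h u v hu hv f₁ hf₁ w
    -- the closed condition `|⟪Φ♯, x⟫| ≤ ‖Φ‖ Λ ‖x‖` ...
    have hC : IsClosed {x : h.Hilbert | ‖⟪Φ', x⟫_ℂ‖ ≤ ‖h.vec w‖ * Λ * ‖x‖} :=
      isClosed_le (continuous_const.inner continuous_id).norm (continuous_const.mul continuous_norm)
    -- ... holds on the span of the field vectors of `𝒯` (the identity read backwards + the hypothesis)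
    have hS : ((Submodule.span ℂ
        {ψ : h.Hilbert | ∃ (x : Σ m : ℕ, 𝓢((Fin m → E4), ℂ)) (hx : x ∈ 𝒯),
          ψ = h.fieldVec x.1 (fun _ => ()) x.2 (h𝒯 x hx)} : Submodule ℂ h.Hilbert) : Set h.Hilbert) ⊆
        {x : h.Hilbert | ‖⟪Φ', x⟫_ℂ‖ ≤ ‖h.vec w‖ * Λ * ‖x‖} := by
      intro x hx
      obtain ⟨k, c, g, rfl⟩ := Submodule.mem_span_set'.1 hx
      have hg : ∀ i, ∃ (G : Σ m : ℕ, 𝓢((Fin m → E4), ℂ)) (hG : G ∈ 𝒯),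
          (g i : h.Hilbert) = h.fieldVec G.1 (fun _ => ()) G.2 (h𝒯 G hG) := fun i => (g i).2
      choose G hG hgG using hg
      have hXG : ∀ i, IsTimeOrdered
          (f₁.appendTensor (translateMulti ((2 * u + v) • EuclideanSpace.single 0 1) (G i).2)) :=
        fun i => isTimeOrdered_sandwich u v hu hv f₁ hf₁ (h𝒯 _ (hG i))
      have hid : ⟪Φ', ∑ i, c i • (g i : h.Hilbert)⟫_ℂ =
          ⟪h.vec w, ∑ i, c i • h.fieldVec (1 + (G i).1) (fun _ => ())
            (f₁.appendTensor (translateMulti ((2 * u + v) • EuclideanSpace.single 0 1) (G i).2))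
              (hXG i)⟫_ℂ := by
        simp only [inner_sum, inner_smul_right]
        refine Finset.sum_congr rfl fun i _ => ?_
        rw [hgG i, hΦ' _ _ (h𝒯 _ (hG i)) (hXG i)]
      show ‖⟪Φ', ∑ i, c i • (g i : h.Hilbert)⟫_ℂ‖ ≤ ‖h.vec w‖ * Λ * ‖∑ i, c i • (g i : h.Hilbert)‖
      rw [hid]
      simp only [hgG]
      calc ‖⟪h.vec w, ∑ i, c i • h.fieldVec (1 + (G i).1) (fun _ => ())
              (f₁.appendTensor (translateMulti ((2 * u + v) • EuclideanSpace.single 0 1) (G i).2))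
                (hXG i)⟫_ℂ‖
          ≤ ‖h.vec w‖ * ‖∑ i, c i • h.fieldVec (1 + (G i).1) (fun _ => ())
              (f₁.appendTensor (translateMulti ((2 * u + v) • EuclideanSpace.single 0 1) (G i).2))
                (hXG i)‖ := norm_inner_le_norm _ _
        _ ≤ ‖h.vec w‖ * (Λ * ‖∑ i, c i • h.fieldVec (G i).1 (fun _ => ()) (G i).2 (h𝒯 _ (hG i))‖) :=
          mul_le_mul_of_nonneg_left (hbound k G hG hXG c) (norm_nonneg _)
        _ = ‖h.vec w‖ * Λ * ‖∑ i, c i • h.fieldVec (G i).1 (fun _ => ()) (G i).2 (h𝒯 _ (hG i))‖ := by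
          ring
    -- ... hence everywhere (density), in particular at `Ψ_W`; then read the identity forwards.
    have hall : ∀ x : h.Hilbert, ‖⟪Φ', x⟫_ℂ‖ ≤ ‖h.vec w‖ * Λ * ‖x‖ := fun x =>
      closure_minimal hS hC (by rw [hdense.closure_eq]; exact Set.mem_univ x)
    rw [hΦ' n W hW hFW]
    exact hall _
  -- Step 2: the `Φ = v(w)` are dense: take `Φ → Ψ_{XW}`.
  have hC : IsClosed {Φ : h.Hilbert | ‖⟪Φ, h.fieldVec (1 + n) (fun _ => ())
      (f₁.appendTensor (translateMulti ((2 * u + v) • EuclideanSpace.single 0 1) W)) hFW⟫_ℂ‖ ≤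
        ‖Φ‖ * Λ * ‖h.fieldVec n (fun _ => ()) W hW‖} :=
    isClosed_le (continuous_id.inner continuous_const).norm
      ((continuous_norm.mul continuous_const).mul continuous_const)
  have hvv := h.denseRange_vec.induction_on
    (p := fun Φ : h.Hilbert => ‖⟪Φ, h.fieldVec (1 + n) (fun _ => ())
      (f₁.appendTensor (translateMulti ((2 * u + v) • EuclideanSpace.single 0 1) W)) hFW⟫_ℂ‖ ≤
        ‖Φ‖ * Λ * ‖h.fieldVec n (fun _ => ()) W hW‖)
    (h.fieldVec (1 + n) (fun _ => ())
      (f₁.appendTensor (translateMulti ((2 * u + v) • EuclideanSpace.single 0 1) W)) hFW) hC hB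
  simp only at hvv
  rw [← inner_self_re_eq_norm, inner_self_eq_norm_mul_norm] at hvv
  by_cases hv0 : ‖h.fieldVec (1 + n) (fun _ => ())
      (f₁.appendTensor (translateMulti ((2 * u + v) • EuclideanSpace.single 0 1) W)) hFW‖ = 0
  · rw [hv0]
    exact mul_nonneg hΛ (norm_nonneg _)
  · have hpos : 0 < ‖h.fieldVec (1 + n) (fun _ => ())
        (f₁.appendTensor (translateMulti ((2 * u + v) • EuclideanSpace.single 0 1) W)) hFW‖ :=
      lt_of_le_of_ne (norm_nonneg _) (Ne.symm hv0)
    refine le_of_mul_le_mul_left ?_ hpos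
    linarith [hvv]

end Summit.QuantumFields.YangMills.Theorems.CurvatureSandwichBound.Sketch

end
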